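import Mathlib
import Summits.AnomalousDissipation.AnomalousDissipation.Theses.LimitingAbsorption
import Literature.Analysis.FluidPDE.PassiveScalarForced
import Literature.Analysis.FluidPDE.PassiveScalar
import Literature.Analysis.FluidPDE.SeisDissipationRateBound
import Literature.Analysis.FluidPDE.ZerothLaw
import HarnessLib

/-!
# Crux `LimitingAbsorption.FloorUpgrade` (stmt-AnomalousDissipation-15010) — crux-ideate round 2,
# ideator 4: sketch of the first lemmas of ideas `material-derivative-dichotomy` (transfer-field /
# Orr-tilt rigidity) and `vorticity-nonrelaxation`.

Everything here is a `def … : Prop` (statements to be proved or refuted by the chain) except the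
two short kernel-checked compositions `kinematicSameFamilyFloor_false_of` and
`noCoRelaxation_of`, which show how the pieces are wired.

Notation (informal): `S_j(t,s)` = propagator of `∂ₜ + v_j·∇ − ν_jΔ`; `θ_j` = `h`-sourced scalar from
zero datum; absorbed power `P_j = limsup-mean ν_j‖∇θ_j‖² = ⟨⟨h, θ_j⟩⟩`.
-/

set_option linter.dupNamespace false

noncomputable section

open MeasureTheory Set Filter Topology
open scoped ENNReal NNReal InnerProductSpace
open Literature.Analysis Literature.Analysis.FluidPDE Literature.Analysis.FluidPDE.Torus
open Summit.AnomalousDissipation.AnomalousDissipation.Theses.LimitingAbsorption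

namespace Summit.AnomalousDissipation.AnomalousDissipation.Cruxes.FloorUpgrade.Ideator4

local notation "𝕋²" => UnitAddTorus (Fin 2)
local notation "E²" => EuclideanSpace ℝ (Fin 2)

/-! ## 1. The coboundary kill lemma (FIRST LEMMA of `material-derivative-dichotomy`; kinematic, exact)

If the steady source is the material derivative of a steady smooth transfer field `χ` along the
drift, `h = u·∇χ` pointwise, then the (unique, bounded-drift) forced weak solution from zero datum is
`θ = χ − S(t,0)χ + κ Ξ` (`Ξ` = scalar sourced by `Δχ`), and its mean dissipation is `≤ 6 κ ‖∇χ‖²`: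
the transient dissipates at most `‖χ‖²/2` in total (Cesàro mean `0`), and the energy inequality for
`Ξ` gives `κ³⟨‖∇Ξ‖²⟩ ≤ κ‖∇χ‖²`. No mixing hypothesis enters. -/
def CoboundaryKill : Prop :=
  ∀ (κ : ℝ) (u : ℝ → 𝕋² → E²) (χ h : 𝕋² → ℝ) (θ : ℝ → 𝕋² → ℝ), 0 < κ →
    FunctionSpaces.Torus.IsSmooth χ → FunctionSpaces.Torus.IsSmooth h →
    (∀ T : ℝ, 0 < T →
      MemLp (FunctionSpaces.Torus.stLift u) ⊤ (volume.restrict (Ioo (0 : ℝ) T ×ˢ univ))) →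
    (∀ t : ℝ, 0 ≤ t → ∀ x, ⟪u t x, FunctionSpaces.Torus.gradient χ x⟫_ℝ = h x) →
    IsWeakScalarTransportForced κ u (fun _ => h) 0 θ →
      longTimeAvgSup (fun t => κ * (eScalarGradNormSq (θ t)).toReal) ≤
        6 * κ * scalarGradNormSq χ

/-! ## 2. The kinematic same-family floor `K1_kin` and the coboundary relaxer conjecture `Q**` -/

/-- A **kinematic relaxer** of the profile `h`: the clauses of `RelaxingFamily` with the
Navier–Stokes/Leray–Hopf clause REMOVED (arbitrary locally bounded drifts `u_j`, smooth in
space-time, divergence free, eventual Cesàro energy `≤ E`), diffusivities `ν_j → 0`, and `(U_h)`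
with constants `(C, γ)` from every phase. -/
def IsKinematicRelaxer (h : 𝕋² → ℝ) (ν : ℕ → ℝ) (u : ℕ → ℝ → 𝕋² → E²) : Prop :=
  FunctionSpaces.Torus.IsSmooth h ∧ FunctionSpaces.Torus.HasZeroMean h ∧ h ≠ 0 ∧
  (∀ j, 0 < ν j) ∧ Tendsto ν atTop (𝓝 0) ∧
  (∀ j, FunctionSpaces.Torus.IsSmoothSpaceTimeOn (Ici (0 : ℝ)) (u j)) ∧
  (∀ j t, 0 ≤ t → FunctionSpaces.Torus.IsDivFree (u j t)) ∧
  (∀ j : ℕ, ∀ T : ℝ, 0 < T →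
    MemLp (FunctionSpaces.Torus.stLift (u j)) ⊤ (volume.restrict (Ioo (0 : ℝ) T ×ˢ univ))) ∧
  (∃ E : ℝ, ∀ j, ∀ᶠ T in atTop, timeMean (fun t => ∫ x, ‖u j t x‖ ^ 2) T ≤ E) ∧
  ∃ C γ : ℝ, 0 ≤ C ∧ 0 < γ ∧ ∀ (j : ℕ) (s : ℝ), 0 ≤ s → ∀ (T : ℝ) (θ : ℝ → 𝕋² → ℝ),
    IsWeakScalarTransportOn T (ν j) (fun t => u j (s + t)) h θ →
      ∀ᵐ t ∂(volume.restrict (Ioo (0 : ℝ) T)),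
        scalarL2Sq (θ t) ≤ C * Real.exp (-(γ * t)) * scalarL2Sq h

/-- **`K1_kin`, the kinematic same-family floor**: every kinematic relaxer of `h` absorbs power from
the steady source `h` at a rate bounded below uniformly in `j` (the `(ABS)` clause of X for the
SAME family and source). This is what every "bookkeeping" proof of `FloorUpgrade` would prove. -/
def KinematicSameFamilyFloor : Prop :=
  ∀ (h : 𝕋² → ℝ) (ν : ℕ → ℝ) (u : ℕ → ℝ → 𝕋² → E²), IsKinematicRelaxer h ν u →
    ∃ ε : ℝ, 0 < ε ∧ ∀ j : ℕ, ∃ θ : ℝ → 𝕋² → ℝ,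
      IsWeakScalarTransportForced (ν j) (u j) (fun _ => h) 0 θ ∧
      ε ≤ longTimeAvgSup (fun t => ν j * (eScalarGradNormSq (θ t)).toReal)

/-- **`Q**`, the coboundary relaxer conjecture** (target of the toy job and of the disprover):
there is a kinematic relaxer of some `h` for which `h` is the EXACT material derivative of a steady
smooth transfer field, `h = u_j(t)·∇χ` for all `j`, `t ≥ 0`. Candidate: `u_j = (a(y), R_j(t,x))`,
`χ = sin(2πx)/(2π)`, `h = a(y) cos(2πx)` with `a` smooth, `∫a = 0`, `a ≡ 0` on a band, and `R_j`
rough vertical shears (coarse overturning + fine shear at wavenumber `m_j → ∞`, `ν_j m_j² ≍ 1`). -/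
def CoboundaryRelaxer : Prop :=
  ∃ (h χ : 𝕋² → ℝ) (ν : ℕ → ℝ) (u : ℕ → ℝ → 𝕋² → E²), IsKinematicRelaxer h ν u ∧
    FunctionSpaces.Torus.IsSmooth χ ∧
    ∀ (j : ℕ) (t : ℝ), 0 ≤ t → ∀ x, ⟪u j t x, FunctionSpaces.Torus.gradient χ x⟫_ℝ = h x

/-- **Wiring (kernel-checked): `CoboundaryKill ∧ Q** ⇒ ¬ K1_kin`.** If a coboundary relaxer
exists, the kinematic same-family floor is false: along that family `P_j ≤ 6 ν_j ‖∇χ‖² → 0`.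
Hence any proof of `FloorUpgrade` must use that the drifts SOLVE Navier–Stokes
(`FloorUpgrade_false_without_NS` in the disprover's nomenclature). [folklore] -/
theorem kinematicSameFamilyFloor_false_of (hK : CoboundaryKill) (hQ : CoboundaryRelaxer) :
    ¬ KinematicSameFamilyFloor := by
  intro hF
  obtain ⟨h, χ, ν, u, hrel, hχ, hcob⟩ := hQ
  obtain ⟨ε, hε, hfloor⟩ := hF h ν u hrel
  obtain ⟨hh, _, _, hνpos, hνlim, _, _, hbd, _⟩ := hrel
  -- pick `j` with `6 ν_j ‖∇χ‖² < ε`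
  set c : ℝ := scalarGradNormSq χ with hc
  have hc0 : 0 ≤ c := integral_nonneg fun _ => sq_nonneg _
  have hev : ∀ᶠ j in atTop, ν j < ε / (6 * c + 1) := by
    have hpos : 0 < ε / (6 * c + 1) := div_pos hε (by positivity)
    exact (tendsto_order.1 hνlim).2 _ hpos
  obtain ⟨j, hj⟩ := hev.exists
  obtain ⟨θ, hθ, hεle⟩ := hfloor j
  have hkill := hK (ν j) (u j) χ h θ (hνpos j) hχ hh (hbd j) (hcob j) hθ
  have h6 : 6 * ν j * c < ε := by
    have h1 : ν j * (6 * c + 1) < ε := by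
      have := hj
      rwa [lt_div_iff₀ (by positivity)] at this
    nlinarith [hνpos j]
  linarith

/-! ## 3. The NS-specific lever: Orr-tilt rigidity (transported vorticity forbids a smooth
cross-foliation velocity component in a rough family) -/

/-- **Orr-tilt rigidity (conjectural, NS-specific; HARDEST input of the line).** For global
Leray–Hopf families of steadily forced 2-D Navier–Stokes with bounded Cesàro energy: if for some
smooth non-constant `χ` the cross-foliation component `v_j·∇χ` is a FIXED smooth steady field `b`
(exactly the structure of every member of the kinematic coboundary class), then the mean enstrophy
is bounded uniformly in `j`. Mechanism: vorticity is materially transported (+ smooth source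
`curl g`, + viscosity); the smooth differential drift `∂_τ(b/|∇χ|) ≢ 0` (forced by incompressibility
unless `h ≡ 0`) tilts every fine vorticity layer out of alignment with the foliation within time
`O(1)`, which makes `v_j·∇χ` rough — so rough vorticity (unbounded enstrophy) is incompatible with a
smooth `b`. With `Seis2022_rmk1_L2` (in tree, proved) bounded enstrophy excludes `(U_h)`, so an NS
relaxing family admits NO exact steady smooth transfer field. -/
def OrrTiltRigidity : Prop :=
  ∀ (g : 𝕋² → E²) (ν : ℕ → ℝ) (v₀ : ℕ → 𝕋² → E²) (v : ℕ → ℝ → 𝕋² → E²) (χ b : 𝕋² → ℝ) (E : ℝ),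
    FunctionSpaces.Torus.IsSmooth g → FunctionSpaces.Torus.IsDivFree g →
    FunctionSpaces.Torus.HasZeroMean g →
    (∀ j, 0 < ν j) → Tendsto ν atTop (𝓝 0) →
    (∀ j, IsGlobalLerayHopf (ν j) (fun _ => g) (v₀ j) (v j)) →
    (∀ j, FunctionSpaces.Torus.IsSmooth (v₀ j)) →
    (∀ j, meanEnergy (v j) ≤ E) →
    FunctionSpaces.Torus.IsSmooth χ → (∃ x y, χ x ≠ χ y) → FunctionSpaces.Torus.IsSmooth b →
    (∀ (j : ℕ) (t : ℝ), 0 ≤ t → ∀ x, ⟪v j t x, FunctionSpaces.Torus.gradient χ x⟫_ℝ = b x) →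
      ∃ Z : ℝ, ∀ j,
        longTimeAvgSup (fun t => (FunctionSpaces.Torus.eGradNormSq (v j t)).toReal) ≤ Z

/-! ## 4. Vorticity non-relaxation (idea `vorticity-nonrelaxation`): an NS relaxing family never
relaxes its own vorticity source profile -/

/-- The planar curl `∂₁g₂ − ∂₂g₁` of a torus field (the vorticity source `curl g`). -/
def planarCurl (g : 𝕋² → E²) (x : 𝕋²) : ℝ :=
  (FunctionSpaces.Torus.partialDeriv 0 g x) 1 - (FunctionSpaces.Torus.partialDeriv 1 g x) 0

/-- **Vorticity-source relaxation bounds the enstrophy (FIRST LEMMA of `vorticity-nonrelaxation`).**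
In 2-D the vorticity `ω_j = curl v_j` of a global Leray–Hopf solution with smooth datum is THE
(`L^∞_t L²_x`, bounded-drift-unique) weak solution of the scalar equation sourced by `curl g`; so if
the family relaxes the profile `curl g` `ν`-uniformly from every phase with constants `(C, γ)`, the
landed inventory bound `RelaxationBoundsInventory` (Duhamel + Minkowski; the transient release of
`ω_j(0)` has Cesàro mean `0` at fixed `ν_j > 0`) caps the mean enstrophy:
`⟨‖ω_j‖²⟩ ≤ 4C‖curl g‖²/γ²`, uniformly in `j`. -/
def VorticitySourceRelaxationBoundsEnstrophy : Prop :=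
  ∀ (g : 𝕋² → E²) (ν : ℕ → ℝ) (v₀ : ℕ → 𝕋² → E²) (v : ℕ → ℝ → 𝕋² → E²) (C γ : ℝ),
    FunctionSpaces.Torus.IsSmooth g → FunctionSpaces.Torus.IsDivFree g →
    FunctionSpaces.Torus.HasZeroMean g → 0 ≤ C → 0 < γ →
    (∀ j, 0 < ν j) →
    (∀ j, IsGlobalLerayHopf (ν j) (fun _ => g) (v₀ j) (v j)) →
    (∀ j, FunctionSpaces.Torus.IsSmooth (v₀ j)) →
    (∀ j : ℕ, ∀ T : ℝ, 0 < T →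
      MemLp (FunctionSpaces.Torus.stLift (v j)) ⊤ (volume.restrict (Ioo (0 : ℝ) T ×ˢ univ))) →
    (∀ (j : ℕ) (s : ℝ), 0 ≤ s → ∀ (T : ℝ) (θ : ℝ → 𝕋² → ℝ),
      IsWeakScalarTransportOn T (ν j) (fun t => v j (s + t)) (planarCurl g) θ →
        ∀ᵐ t ∂(volume.restrict (Ioo (0 : ℝ) T)),
          scalarL2Sq (θ t) ≤ C * Real.exp (-(γ * t)) * scalarL2Sq (planarCurl g)) →
      ∀ j, longTimeAvgSup (fun t => (FunctionSpaces.Torus.eGradNormSq (v j t)).toReal) ≤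
        4 * C / γ ^ 2 * scalarL2Sq (planarCurl g)

/-- **Bounded enstrophy excludes uniform relaxation (Seis, in tree as `Seis2022_rmk1_L2_holds`,
here in the family form the crux needs).** A family of locally bounded drifts with mean enstrophy
`≤ Z` uniformly in `j` and `ν_j → 0` cannot relax a smooth mean-zero `h ≠ 0` with `j`-uniform
`(C, γ)` from every phase (rate `γ ≲ √Z / log(1/ν_j) → 0`). Support-sized given the tree fact
(Cesàro-in-time enstrophy via Remark 1's `∫₀ᵗ‖∇u‖ ≲ 1 + t`). -/
def BoundedEnstrophyNoRelaxation : Prop :=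
  ∀ (h : 𝕋² → ℝ) (ν : ℕ → ℝ) (v : ℕ → ℝ → 𝕋² → E²) (Z C γ : ℝ),
    FunctionSpaces.Torus.IsSmooth h → FunctionSpaces.Torus.HasZeroMean h → h ≠ 0 →
    (∀ j, 0 < ν j) → Tendsto ν atTop (𝓝 0) → 0 ≤ C → 0 < γ →
    (∀ j : ℕ, ∀ T : ℝ, 0 < T →
      MemLp (FunctionSpaces.Torus.stLift (v j)) ⊤ (volume.restrict (Ioo (0 : ℝ) T ×ˢ univ))) →
    (∀ j, longTimeAvgSup (fun t => (FunctionSpaces.Torus.eGradNormSq (v j t)).toReal) ≤ Z) →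
    ¬ (∀ (j : ℕ) (s : ℝ), 0 ≤ s → ∀ (T : ℝ) (θ : ℝ → 𝕋² → ℝ),
        IsWeakScalarTransportOn T (ν j) (fun t => v j (s + t)) h θ →
          ∀ᵐ t ∂(volume.restrict (Ioo (0 : ℝ) T)),
            scalarL2Sq (θ t) ≤ C * Real.exp (-(γ * t)) * scalarL2Sq h)

/-- **No co-relaxation of `h` and `curl g` (the selectivity law of NS relaxing families).**
A `RelaxingFamily`-type family (smooth data) that ALSO relaxes its own vorticity source `curl g`
uniformly does not exist: NS relaxing families are necessarily SELECTIVE mixers — they transport the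
unit-variance field `ω_j/√Z_j` (source `curl g/√Z_j → 0`, relative dissipation `η_j/Z_j → 0`)
without dissipating it. In particular the design `h ∈ span{curl g}` is dead, and no line may use
data-uniform ("operator-norm") relaxation. -/
def NoCoRelaxation : Prop :=
  ∀ (g : 𝕋² → E²) (h : 𝕋² → ℝ) (ν : ℕ → ℝ) (v₀ : ℕ → 𝕋² → E²) (v : ℕ → ℝ → 𝕋² → E²) (C γ : ℝ),
    FunctionSpaces.Torus.IsSmooth g → FunctionSpaces.Torus.IsDivFree g →
    FunctionSpaces.Torus.HasZeroMean g →
    FunctionSpaces.Torus.IsSmooth h → FunctionSpaces.Torus.HasZeroMean h → h ≠ 0 →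
    0 ≤ C → 0 < γ → (∀ j, 0 < ν j) → Tendsto ν atTop (𝓝 0) →
    (∀ j, IsGlobalLerayHopf (ν j) (fun _ => g) (v₀ j) (v j)) →
    (∀ j, FunctionSpaces.Torus.IsSmooth (v₀ j)) →
    (∀ j : ℕ, ∀ T : ℝ, 0 < T →
      MemLp (FunctionSpaces.Torus.stLift (v j)) ⊤ (volume.restrict (Ioo (0 : ℝ) T ×ˢ univ))) →
    (∀ (j : ℕ) (s : ℝ), 0 ≤ s → ∀ (T : ℝ) (θ : ℝ → 𝕋² → ℝ),
      IsWeakScalarTransportOn T (ν j) (fun t => v j (s + t)) (planarCurl g) θ →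
        ∀ᵐ t ∂(volume.restrict (Ioo (0 : ℝ) T)),
          scalarL2Sq (θ t) ≤ C * Real.exp (-(γ * t)) * scalarL2Sq (planarCurl g)) →
    ¬ (∀ (j : ℕ) (s : ℝ), 0 ≤ s → ∀ (T : ℝ) (θ : ℝ → 𝕋² → ℝ),
        IsWeakScalarTransportOn T (ν j) (fun t => v j (s + t)) h θ →
          ∀ᵐ t ∂(volume.restrict (Ioo (0 : ℝ) T)),
            scalarL2Sq (θ t) ≤ C * Real.exp (-(γ * t)) * scalarL2Sq h)

/-- **Wiring (kernel-checked):** the selectivity law from its two halves. [folklore] -/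
theorem noCoRelaxation_of (hV : VorticitySourceRelaxationBoundsEnstrophy)
    (hS : BoundedEnstrophyNoRelaxation) : NoCoRelaxation := by
  intro g h ν v₀ v C γ hg hgd hgm hh hhm hh0 hC hγ hν hνlim hLH hsm hbd hUcurl
  exact hS h ν v _ C γ hh hhm hh0 hν hνlim hC hγ hbd
    (hV g ν v₀ v C γ hg hgd hgm hC hγ hν hLH hsm hbd hUcurl)

end Summit.AnomalousDissipation.AnomalousDissipation.Cruxes.FloorUpgrade.Ideator4

end
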